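import Summits.QuantumAdvantage.QuantumAdvantage.Theorems.CubicForrelationNearExactIsExactCubicFormSymplectic
import Summits.QuantumAdvantage.QuantumAdvantage.Theorems.CubicForrelationNearExactIsExactTwelveOddWeightLight

/-!
# Crux `CubicForrelation.NearExactIsExact` (stmt-QuantumAdvantage-14043) — maximal symplectic frames INSIDE A HYPERPLANE `ker z`

Certificate seat `b2b-cforr-cert` (gen 40).  HONEST FRAMING: kernel-checked folklore (standard axioms), tool T5' of the Lean roadmap for
`E1280-even` (HOME/b2b-cforr-cert-g40/LEAN-PLAN-E1280-EVEN.md §4): the Kasami–Tokura class of a light cell with cubic form `t̄ = z ∧ B`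
(…CubicFormHyperplane) is the size of a maximal symplectic frame of `B` RESTRICTED TO `ker z`; this file produces such a frame from
`tcs_frame_exists` (…CubicFormSymplectic) applied to the form pulled back along the projection `π(v) = v ⊕ ⟨v,z⟩·v₀` onto `ker z`.
Nothing about `θ₁₂`; NOT summit progress.

* `tck_proj_mem`, `tck_proj_id`: `⟨π v, z⟩ = 0`, and `π v = v` on `ker z` (`⟨v₀,z⟩ = 1`).
* `tck_frame_exists_ker`: for a symmetric `Bool` form `B` with `B(x,x) = 0` there is a frame `(bᵢ, cᵢ)_{i<h}` INSIDE `ker z` with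
  `B(bᵢ,cⱼ) = [i=j]`, `B(b,b) = B(c,c) = 0`, maximal in `ker z`: `B(x,y) = 0` for all `x, y ∈ ker z` orthogonal to the frame.

References: F. J. MacWilliams, N. J. A. Sloane (1977) Ch. 15 §2.  Axioms: the standard three.
-/

set_option linter.dupNamespace false -- D-0017: single-problem summit ⇒ `QuantumAdvantage.QuantumAdvantage` by design

namespace Summit.QuantumAdvantage.QuantumAdvantage.Theorems.CubicForrelation.NearExactIsExact

open Finset
open Literature.Computability.QuantumComplexity.BuzetChailloux (bxor zeroVec bxor_zeroVec bxor_self)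

variable {n : ℕ}

/-- Parity of a scaled vector: `⟨β·v, z⟩ = β ∧ ⟨v,z⟩`. [folklore] -/
theorem tck_parity_smul_left (β : Bool) (v z : Fin n → Bool) :
    decide (Odd #(univ.filter fun j => (β && v j) && z j)) = (β && decide (Odd #(univ.filter fun j => v j && z j))) := by
  cases β
  · simp
  · simp only [Bool.true_and]

section Ker

variable (z v₀ : Fin n → Bool) (hv₀ : decide (Odd #(univ.filter fun j => v₀ j && z j)) = true)
include hv₀

/-- The projection `π(v) = v ⊕ ⟨v,z⟩·v₀` lands in `ker z`. [folklore] -/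
theorem tck_proj_mem (v : Fin n → Bool) :
    decide (Odd #(univ.filter fun j =>
      (bxor v (fun l => decide (Odd #(univ.filter fun j => v j && z j)) && v₀ l)) j && z j)) = false := by
  rw [tow_parity_bxor, tck_parity_smul_left, hv₀, Bool.and_true, Bool.xor_self]

omit hv₀ in
/-- The projection is the identity on `ker z`. [folklore] -/
theorem tck_proj_id (v : Fin n → Bool) (hv : decide (Odd #(univ.filter fun j => v j && z j)) = false) :
    bxor v (fun l => decide (Odd #(univ.filter fun j => v j && z j)) && v₀ l) = v := by
  rw [hv]
  funext l
  simp [bxor]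

/-- **Maximal symplectic frames inside `ker z`.**  Let `B` be a symmetric `Bool` form on `𝔽₂ⁿ` with `B(x,x) = 0`, and `z, v₀` with
`⟨v₀,z⟩ = 1`.  Then there are `h` and vectors `bᵢ, cᵢ ∈ ker z` (`i < h`) with `B(bᵢ,cⱼ) = [i = j]`, `B(bᵢ,bⱼ) = B(cᵢ,cⱼ) = 0`, such that
`B(x,y) = 0` whenever `x, y ∈ ker z` are `B`-orthogonal to every `bᵢ, cᵢ`. [folklore; cite: MacWilliamsSloane1977, Ch. 15 §2] -/
theorem tck_frame_exists_ker (B : (Fin n → Bool) → (Fin n → Bool) → Bool) (hsymm : ∀ x y, B x y = B y x) (halt : ∀ x, B x x = false) :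
    ∃ (h : ℕ) (b c : Fin h → (Fin n → Bool)),
      (∀ i, decide (Odd #(univ.filter fun j => b i j && z j)) = false) ∧ (∀ i, decide (Odd #(univ.filter fun j => c i j && z j)) = false) ∧
      (∀ i, B (b i) (c i) = true) ∧ (∀ i j, i ≠ j → B (b i) (c j) = false) ∧
      (∀ i j, B (b i) (b j) = false) ∧ (∀ i j, B (c i) (c j) = false) ∧
      (∀ x y, decide (Odd #(univ.filter fun j => x j && z j)) = false → decide (Odd #(univ.filter fun j => y j && z j)) = false →
        (∀ i, B x (b i) = false) → (∀ i, B x (c i) = false) → (∀ i, B y (b i) = false) → (∀ i, B y (c i) = false) →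
        B x y = false) := by
  -- the pulled-back form
  set π : (Fin n → Bool) → (Fin n → Bool) := fun v => bxor v (fun l => decide (Odd #(univ.filter fun j => v j && z j)) && v₀ l) with hπ
  have hπmem : ∀ v, decide (Odd #(univ.filter fun j => π v j && z j)) = false := fun v => tck_proj_mem z v₀ hv₀ v
  have hπid : ∀ v, decide (Odd #(univ.filter fun j => v j && z j)) = false → π v = v := fun v hv => tck_proj_id z v₀ v hv
  set B' : (Fin n → Bool) → (Fin n → Bool) → Bool := fun v w => B (π v) (π w) with hB'
  have hsymm' : ∀ x y, B' x y = B' y x := fun x y => hsymm _ _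
  have halt' : ∀ x, B' x x = false := fun x => halt _
  obtain ⟨h, b', c', h1, h2, h3, h4, hmax⟩ := tcs_frame_exists B' hsymm' halt'
  refine ⟨h, fun i => π (b' i), fun i => π (c' i), fun i => hπmem _, fun i => hπmem _, h1, h2, h3, h4,
    fun x y hx hy hxb hxc hyb hyc => ?_⟩
  have ex : π x = x := hπid x hx
  have ey : π y = y := hπid y hy
  have key := hmax x y (fun i => ?_) (fun i => ?_) (fun i => ?_) (fun i => ?_)
  · simpa only [hB', ex, ey] using key
  · show B (π x) (π (b' i)) = false
    rw [ex]; exact hxb i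
  · show B (π x) (π (c' i)) = false
    rw [ex]; exact hxc i
  · show B (π y) (π (b' i)) = false
    rw [ey]; exact hyb i
  · show B (π y) (π (c' i)) = false
    rw [ey]; exact hyc i

end Ker

end Summit.QuantumAdvantage.QuantumAdvantage.Theorems.CubicForrelation.NearExactIsExact
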